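import Mathlib
import Summits.ResolutionOfSingularities.ResolutionOfSingularities.Theorems.HomologicalConductorPersistenceBranchedCover
import HarnessLib

/-!
# `ca` of an iterated double cover: transport of Esentepe's Theorem 5.4 and the «u² + v² + g» formula
# (W4.4b F-DP part 3)

Route `ResolutionOfSingularities/HomologicalConductor`, chain W4.4b (cell `res-hironaka`), crux `Persistence`
(stmt-ResolutionOfSingularities-16484), §«cA arena» (res-L1-w44b-plan-1 CUT K-v13 / F-DP 2026-08-27T10:27:47Z; §H2L sizing
K2a, 11:12Z).  [OURS; AI-written, weaker than expert review; NOT a statement of the manuscript under study (Hironaka 2017), and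
no statement of that manuscript is used.]

Part 2 (`…PersistenceBranchedCover`, p526344) proved, modulo the NAMED FACT [Esentepe2020, Thm. 5.4, `m = 2`]
(`doubleBranchedCover_map_cohomologyAnnihilator_eq`, p525400): for `S = k⟦x₁,…,xₙ⟧ = MvPowerSeries (Fin n) k`, `char k ≠ 2`,
`0 ≠ f ∈ 𝔪_S`, the double cover `R♯ = S⟦y⟧/(f + y²)` has `ca(R♯) = π⁻¹(ca(S/(f)))`.  The named fact is stated for the base
ring LITERALLY `MvPowerSeries (Fin n) k`; to iterate it (the second cover has base `S⟦u⟧`, a power series ring in `n + 1`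
variables only up to isomorphism) this file proves:

* `cohomologyAnnihilator_doubleBranchedCover_eq_comap_of_ringEquiv` — TRANSPORT: the part-2 formula for any base ring
  `S'` with a ring isomorphism `e : S' ≃+* k⟦x₁,…,xₙ⟧` (and `0 ≠ f'`, `e f' ∈ 𝔪`): power series and quotients are functorial
  in ring isomorphisms (`PowerSeries.map`, `Ideal.quotientEquiv`), `ca` is invariant (`map_ringEquiv_cohomologyAnnihilator`),
  and the projections commute with the induced isomorphisms;
* `powerSeriesMvPowerSeriesEquiv` (inline) — `k⟦x₁,…,xₙ⟧⟦u⟧ ≃+* k⟦x₁,…,xₙ₊₁⟧` (`nestedEquiv` + `renameEquiv`);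
* **`cohomologyAnnihilator_doubleDoubleCover_eq_comap`** — the ITERATE: for `0 ≠ g ∈ 𝔪_S`,
  `T := S⟦u⟧⟦v⟧ / (g + u² + v²)` (= `BranchedCover (PowerSeries S) (C g + u²) 2`, whose first projection lands in
  `BranchedCover S g 2 = S⟦u⟧/(g + u²)`) has **`ca(T) = (π₁ ∘ π₂)⁻¹(ca(S/(g)))`**, hence contains `ū`, `v̄` and every lift of
  `ca(S/(g))` (`mk_mem_cohomologyAnnihilator_doubleDoubleCover_of_mem`).  For the cA arena `T_h = k⟦x,y,z,t⟧/(xy − h)` take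
  `g = −h` and `x = u + iv`, `y = u − iv` (`char ≠ 2`, `i² = −1`): the reader's change of coordinates (planner 10:27:47Z).

Everything here is conditional exactly on the one named fact (hypothesis `hE`), as in part 2.  Filed
`--supports stmt-ResolutionOfSingularities-16484 --as helper`.  Reference: Ö. Esentepe, J. Algebra 541 (2020), arXiv:1807.05471,
Thm. 5.4 [`Esentepe2020`].
-/

noncomputable section

-- single-problem summit: the doubled namespace component `ResolutionOfSingularities` is forced
set_option linter.dupNamespace false

namespace Summit.ResolutionOfSingularities.ResolutionOfSingularities.Theorems.HomologicalConductor.PersistenceBranchedCoverIterate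

open PowerSeries Literature.RingTheory.CohomologyAnnihilator Literature.AlgebraicGeometry.Resolution
open Summit.ResolutionOfSingularities.ResolutionOfSingularities.Theorems.HomologicalConductor.PersistenceBranchedCover

universe u

/-! ## Transport of the double-cover formula along a ring isomorphism of the base -/

/-- `ca` pulled back along a ring isomorphism: `ca(A) = E⁻¹(ca(B))` for `E : A ≃+* B` (from the tree's
`map_ringEquiv_cohomologyAnnihilator`). [folklore] -/
theorem cohomologyAnnihilator_eq_comap_ringEquiv {A B : Type u} [CommRing A] [CommRing B] (E : A ≃+* B) :
    cohomologyAnnihilator A = (cohomologyAnnihilator B).comap (E : A →+* B) := by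
  rw [← map_ringEquiv_cohomologyAnnihilator E]
  exact (Ideal.comap_map_of_bijective (E : A →+* B) (by exact E.bijective)).symm

/-- **TRANSPORT.**  Let `e : S' ≃+* S = k⟦x₁,…,xₙ⟧` be a ring isomorphism, `char k ≠ 2`, `f' ∈ S'` with `f' ≠ 0` and
`e f' ∈ 𝔪_S`.  Then the double branched cover over `S'` satisfies the part-2 formula:
`ca(S'⟦y⟧/(f' + y²)) = π'⁻¹(ca(S'/(f')))`.  Proof: `PowerSeries.map e` induces `E : BranchedCover S' f' 2 ≃+* BranchedCover S (e f') 2`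
and `e` induces `Ē : S'/(f') ≃+* S/(e f')` (`Ideal.quotientEquiv`) with `π ∘ E = Ē ∘ π'`; `ca` is carried to `ca` by ring
isomorphisms (`map_ringEquiv_cohomologyAnnihilator`), so the formula over `S` (part 2) pulls back.
[cite: Esentepe2020, Theorem 5.4 (consequence)] -/
theorem cohomologyAnnihilator_doubleBranchedCover_eq_comap_of_ringEquiv
    (hE : doubleBranchedCover_map_cohomologyAnnihilator_eq.{u}) (k : Type u) [Field k] (hchar : ringChar k ≠ 2) (n : ℕ)
    {S' : Type u} [CommRing S'] (e : S' ≃+* MvPowerSeries (Fin n) k) (f' : S')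
    (hf : MvPowerSeries.constantCoeff (e f') = 0) (hf0 : f' ≠ 0) :
    cohomologyAnnihilator (BranchedCover S' f' 2) =
      (cohomologyAnnihilator (S' ⧸ Ideal.span {f'})).comap (branchedCoverProjection S' f' 2) := by
  set S := MvPowerSeries (Fin n) k with hSdef
  set f : S := e f' with hfdef
  have hf0' : f ≠ 0 := fun h => hf0 (by simpa [hfdef] using congrArg e.symm h)
  have base := cohomologyAnnihilator_doubleBranchedCover_eq_comap hE k hchar n f hf hf0'
  -- the power-series isomorphism `Pe : S'⟦y⟧ ≃+* S⟦y⟧`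
  let Pe : PowerSeries S' ≃+* PowerSeries S :=
    RingEquiv.ofRingHom (PowerSeries.map (e : S' →+* S)) (PowerSeries.map (e.symm : S →+* S'))
      (by rw [← PowerSeries.map_comp, RingEquiv.comp_symm]; exact RingHom.ext (congrFun map_id))
      (by rw [← PowerSeries.map_comp, RingEquiv.symm_comp]; exact RingHom.ext (congrFun map_id))
  have hPe : ∀ a : PowerSeries S', Pe a = PowerSeries.map (e : S' →+* S) a := fun a => rfl
  have hPe_gen : Pe (C f' + X ^ 2) = C f + X ^ 2 := by
    rw [hPe, map_add, map_pow, PowerSeries.map_C, PowerSeries.map_X]; rfl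
  -- the induced isomorphisms of the covers and of the bases
  have hIJ : Ideal.span {(C f + X ^ 2 : PowerSeries S)} =
      (Ideal.span {(C f' + X ^ 2 : PowerSeries S')}).map (Pe : PowerSeries S' →+* PowerSeries S) := by
    rw [Ideal.map_span, Set.image_singleton, RingHom.coe_coe, hPe_gen]
  let E : BranchedCover S' f' 2 ≃+* BranchedCover S f 2 := Ideal.quotientEquiv _ _ Pe hIJ
  have hIJ' : Ideal.span {f} = (Ideal.span {f'}).map (e : S' →+* S) := by
    rw [Ideal.map_span, Set.image_singleton, RingHom.coe_coe]
  let Ebar : (S' ⧸ Ideal.span {f'}) ≃+* (S ⧸ Ideal.span {f}) := Ideal.quotientEquiv _ _ e hIJ'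
  -- compatibility of the projections
  have hcompat : (branchedCoverProjection S f 2).comp (E : BranchedCover S' f' 2 →+* BranchedCover S f 2) =
      (Ebar : (S' ⧸ Ideal.span {f'}) →+* (S ⧸ Ideal.span {f})).comp (branchedCoverProjection S' f' 2) := by
    refine Ideal.Quotient.ringHom_ext (RingHom.ext fun a => ?_)
    change branchedCoverProjection S f 2 (E (Ideal.Quotient.mk _ a)) =
      Ebar (branchedCoverProjection S' f' 2 (Ideal.Quotient.mk _ a))
    rw [branchedCoverProjection_mk]
    change branchedCoverProjection S f 2 (Ideal.Quotient.mk _ (Pe a)) = Ideal.Quotient.mk _ (e (constantCoeff a))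
    rw [branchedCoverProjection_mk, hPe, ← coeff_zero_eq_constantCoeff_apply, coeff_map,
      coeff_zero_eq_constantCoeff_apply]
    rfl
  -- transport of `ca` and of the comaps
  have h1 : cohomologyAnnihilator (BranchedCover S' f' 2) =
      (cohomologyAnnihilator (BranchedCover S f 2)).comap (E : BranchedCover S' f' 2 →+* BranchedCover S f 2) :=
    cohomologyAnnihilator_eq_comap_ringEquiv E
  have h2 : cohomologyAnnihilator (S' ⧸ Ideal.span {f'}) =
      (cohomologyAnnihilator (S ⧸ Ideal.span {f})).comap (Ebar : (S' ⧸ Ideal.span {f'}) →+* (S ⧸ Ideal.span {f})) :=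
    cohomologyAnnihilator_eq_comap_ringEquiv Ebar
  rw [h1, base, Ideal.comap_comap, hcompat, ← Ideal.comap_comap, ← h2]

/-! ## `k⟦x₁,…,xₙ⟧⟦u⟧ ≅ k⟦x₁,…,xₙ₊₁⟧` -/

/-- A ring isomorphism `k⟦x₁,…,xₙ⟧⟦u⟧ ≃+* k⟦x₁,…,xₙ₊₁⟧` (tree `MvPowerSeriesNested.nestedEquiv` followed by renaming the
variables `Unit ⊕ Fin n ≃ Fin (n + 1)`); which variable `u` becomes is immaterial for `ca`. [folklore] -/
theorem nonempty_powerSeries_ringEquiv_mvPowerSeries (k : Type u) [Field k] (n : ℕ) :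
    Nonempty (PowerSeries (MvPowerSeries (Fin n) k) ≃+* MvPowerSeries (Fin (n + 1)) k) := by
  let ε : Unit ⊕ Fin n ≃ Fin (n + 1) := Fintype.equivOfCardEq (by simp [add_comm])
  exact ⟨(MvPowerSeriesNested.nestedEquiv Unit (Fin n) k).symm.trans (MvPowerSeries.renameEquiv k ε).toRingEquiv⟩

/-! ## The iterate: `ca(S⟦u⟧⟦v⟧/(g + u² + v²)) = (π₁ ∘ π₂)⁻¹(ca(S/(g)))` -/

/-- The first-cover generator `C g + u²` is non-zero and non-unit in `S⟦u⟧` when `g ∈ 𝔪_S`: transported along any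
isomorphism `e : S⟦u⟧ ≃+* k⟦x₁,…,xₙ₊₁⟧` its constant coefficient vanishes. [folklore] -/
theorem constantCoeff_ringEquiv_generator_eq_zero (k : Type u) [Field k] (n : ℕ) (g : MvPowerSeries (Fin n) k)
    (hg : MvPowerSeries.constantCoeff g = 0)
    (e : PowerSeries (MvPowerSeries (Fin n) k) ≃+* MvPowerSeries (Fin (n + 1)) k) :
    MvPowerSeries.constantCoeff (e (C g + X ^ 2)) = 0 := by
  by_contra hne
  have hu : IsUnit (e (C g + X ^ 2)) :=
    MvPowerSeries.isUnit_iff_constantCoeff.mpr (Ne.isUnit hne)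
  have hu' : IsUnit (C g + X ^ 2 : PowerSeries (MvPowerSeries (Fin n) k)) := by
    simpa using hu.map e.symm
  rw [PowerSeries.isUnit_iff_constantCoeff, map_add, map_pow, constantCoeff_C, constantCoeff_X,
    zero_pow two_ne_zero, add_zero, MvPowerSeries.isUnit_iff_constantCoeff, hg] at hu'
  exact not_isUnit_zero hu'

/-- **THE ITERATED DOUBLE COVER [OURS · F-DP part 3]:** for `S = k⟦x₁,…,xₙ⟧`, `char k ≠ 2`, `0 ≠ g ∈ 𝔪_S`, the ring
`T = S⟦u⟧⟦v⟧ / (g + u² + v²)` — realised as the double branched cover `BranchedCover (PowerSeries S) (C g + u²) 2` of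
`S⟦u⟧/(g + u²) = BranchedCover S g 2`, itself the double branched cover of `S/(g)` — has
**`ca(T) = (π₁ ∘ π₂)⁻¹(ca(S/(g)))`**, `π₂ : T → S⟦u⟧/(g + u²)` (`v ↦ 0`), `π₁ : S⟦u⟧/(g + u²) → S/(g)` (`u ↦ 0`).
Two applications of [Esentepe2020, Thm. 5.4] (`m = 2`): part 2 for the first cover, the TRANSPORTED form
(`…_of_ringEquiv` along `S⟦u⟧ ≅ k⟦x₁,…,xₙ₊₁⟧`) for the second.  For the cA arena: `k⟦x,y,z,t⟧/(xy − h)` is `T` with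
`S = k⟦z,t⟧`, `g = −h`, `x = u + iv`, `y = u − iv` (`i² = −1`, `char ≠ 2`) — the reader's change of coordinates.
[cite: Esentepe2020, Theorem 5.4 (consequence)] -/
theorem cohomologyAnnihilator_doubleDoubleCover_eq_comap
    (hE : doubleBranchedCover_map_cohomologyAnnihilator_eq.{u}) (k : Type u) [Field k] (hchar : ringChar k ≠ 2) (n : ℕ)
    (g : MvPowerSeries (Fin n) k) (hg : MvPowerSeries.constantCoeff g = 0) (hg0 : g ≠ 0) :
    cohomologyAnnihilator
        (BranchedCover (PowerSeries (MvPowerSeries (Fin n) k)) (C g + X ^ 2 : PowerSeries (MvPowerSeries (Fin n) k)) 2) =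
      (cohomologyAnnihilator (MvPowerSeries (Fin n) k ⧸ Ideal.span {g})).comap
        ((branchedCoverProjection (MvPowerSeries (Fin n) k) g 2).comp
          (branchedCoverProjection (PowerSeries (MvPowerSeries (Fin n) k))
            (C g + X ^ 2 : PowerSeries (MvPowerSeries (Fin n) k)) 2)) := by
  obtain ⟨e⟩ := nonempty_powerSeries_ringEquiv_mvPowerSeries k n
  haveI : IsDomain (MvPowerSeries (Fin n) k) := NoZeroDivisors.to_isDomain _
  have hF0 : (C g + X ^ 2 : PowerSeries (MvPowerSeries (Fin n) k)) ≠ 0 :=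
    nonZeroDivisors.ne_zero (generator_mem_nonZeroDivisors g)
  have step2 := cohomologyAnnihilator_doubleBranchedCover_eq_comap_of_ringEquiv hE k hchar (n + 1) e
    (C g + X ^ 2) (constantCoeff_ringEquiv_generator_eq_zero k n g hg e) hF0
  have step1 := cohomologyAnnihilator_doubleBranchedCover_eq_comap hE k hchar n g hg hg0
  rw [step2, ← Ideal.comap_comap]
  -- `S⟦u⟧ ⧸ (C g + u²)` IS `BranchedCover S g 2`
  exact congrArg (Ideal.comap _) step1

/-- **Lifting into the iterated cover**: every `a ∈ S⟦u⟧⟦v⟧` whose double constant coefficient lies in `ca(S/(g))` has its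
class in `ca(T)`; in particular `ū`, `v̄` and the lifts `C (C s)` of `s̄ ∈ ca(S/(g))` (e.g. of the conductor of a plane
curve, [Esentepe2020, Thm. 4.4]) lie in `ca(T)`. [cite: Esentepe2020, Theorem 5.4 (consequence)] -/
theorem mk_mem_cohomologyAnnihilator_doubleDoubleCover_of_mem
    (hE : doubleBranchedCover_map_cohomologyAnnihilator_eq.{u}) (k : Type u) [Field k] (hchar : ringChar k ≠ 2) (n : ℕ)
    (g : MvPowerSeries (Fin n) k) (hg : MvPowerSeries.constantCoeff g = 0) (hg0 : g ≠ 0)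
    (a : PowerSeries (PowerSeries (MvPowerSeries (Fin n) k)))
    (ha : Ideal.Quotient.mk (Ideal.span {g}) (constantCoeff (constantCoeff a)) ∈
      cohomologyAnnihilator (MvPowerSeries (Fin n) k ⧸ Ideal.span {g})) :
    Ideal.Quotient.mk _ a ∈ cohomologyAnnihilator
      (BranchedCover (PowerSeries (MvPowerSeries (Fin n) k)) (C g + X ^ 2 : PowerSeries (MvPowerSeries (Fin n) k)) 2) := by
  rw [cohomologyAnnihilator_doubleDoubleCover_eq_comap hE k hchar n g hg hg0, Ideal.mem_comap]
  exact ha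

/-- `v̄ ∈ ca(T)` for the iterated cover (its double constant coefficient is `0`). [cite: Esentepe2020, Theorem 5.4 (consequence)] -/
theorem mk_X_mem_cohomologyAnnihilator_doubleDoubleCover
    (hE : doubleBranchedCover_map_cohomologyAnnihilator_eq.{u}) (k : Type u) [Field k] (hchar : ringChar k ≠ 2) (n : ℕ)
    (g : MvPowerSeries (Fin n) k) (hg : MvPowerSeries.constantCoeff g = 0) (hg0 : g ≠ 0) :
    Ideal.Quotient.mk _ (X : PowerSeries (PowerSeries (MvPowerSeries (Fin n) k))) ∈ cohomologyAnnihilator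
      (BranchedCover (PowerSeries (MvPowerSeries (Fin n) k)) (C g + X ^ 2 : PowerSeries (MvPowerSeries (Fin n) k)) 2) :=
  mk_mem_cohomologyAnnihilator_doubleDoubleCover_of_mem hE k hchar n g hg hg0 X
    (by rw [constantCoeff_X, map_zero, map_zero]; exact Ideal.zero_mem _)

/-- `ū ∈ ca(T)` for the iterated cover (`u = C X` has double constant coefficient `0`).
[cite: Esentepe2020, Theorem 5.4 (consequence)] -/
theorem mk_C_X_mem_cohomologyAnnihilator_doubleDoubleCover
    (hE : doubleBranchedCover_map_cohomologyAnnihilator_eq.{u}) (k : Type u) [Field k] (hchar : ringChar k ≠ 2) (n : ℕ)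
    (g : MvPowerSeries (Fin n) k) (hg : MvPowerSeries.constantCoeff g = 0) (hg0 : g ≠ 0) :
    Ideal.Quotient.mk _ (C (X : PowerSeries (MvPowerSeries (Fin n) k))) ∈ cohomologyAnnihilator
      (BranchedCover (PowerSeries (MvPowerSeries (Fin n) k)) (C g + X ^ 2 : PowerSeries (MvPowerSeries (Fin n) k)) 2) :=
  mk_mem_cohomologyAnnihilator_doubleDoubleCover_of_mem hE k hchar n g hg hg0 (C X)
    (by rw [constantCoeff_C, constantCoeff_X, map_zero]; exact Ideal.zero_mem _)

end Summit.ResolutionOfSingularities.ResolutionOfSingularities.Theorems.HomologicalConductor.PersistenceBranchedCoverIterate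

end
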